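import Summits.ABC.IUTFork.DAGL4p
import Summits.ABC.IUTFork.DAGL4t
import Summits.ABC.IUTFork.DAGL4u
import Summits.ABC.IUTFork.DAGRd
import Summits.ABC.IUTFork.DAGXc

/-!
# Kernel DAG index — witness UPGRADE part zd (GENERATED by abc-iut-c312-2 gen 7 `work/gen_index.py upgrade` @2026-08-27T09:08Z from HOME/plan/DAG.tsv
(regenerated 2026-08-27T09:03:16Z); spec v1.3 §2(c) "`_holds` iff the DAG row is discharged", §5 "re-file when nodes change status")

THIS FILE PROVES NOTHING NEW AND ASSERTS NOTHING. For 7 nodes ALREADY INDEXED with a partial witness `N_<id>_part` (their DAG row was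
`landed(p…)` when indexed) whose row is NOW `discharged(p…)`, it adds the discharge witness `N_<id>_holds : N_<id> := N_<id>_part` BY NAME —
the node statement `N_<id>` is untouched (append-only across files: nothing landed is redefined). Nothing here says abc is proved or refuted
or takes a side on [IUTchIII] Cor 3.12. typed ≠ discharged; indexed ≠ endorsed.
-/

namespace Summit.ABC.IUTFork.DAG

/-- [node EtTh:Cor2.8(i) · L2/D1 · DAG status discharged(p516169)] discharge witness of `N_EtTh_Cor2_8_i'` (indexed in `DAGRd` with `_part` while the row was landed; now discharged, p516169): BY NAME; proves nothing new. -/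
theorem N_EtTh_Cor2_8_i'_holds : N_EtTh_Cor2_8_i' := N_EtTh_Cor2_8_i'_part

/-- [node AbsTopIII:Cor1.10(iii) · L4/D1 · DAG status discharged(p492528)] discharge witness of `N_AbsTopIII_Cor1_10_iii` (indexed in `DAGL4p` with `_part` while the row was landed; now discharged, p492528): BY NAME; proves nothing new. -/
theorem N_AbsTopIII_Cor1_10_iii_holds : N_AbsTopIII_Cor1_10_iii := N_AbsTopIII_Cor1_10_iii_part

/-- [node AbsTopIII:Cor5.5(i) · L4/D1 · DAG status discharged(p410593+p438504)] discharge witness of `N_AbsTopIII_Cor5_5_i` (indexed in `DAGL4t` with `_part` while the row was landed; now discharged, p410593): BY NAME; proves nothing new. -/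
theorem N_AbsTopIII_Cor5_5_i_holds : N_AbsTopIII_Cor5_5_i := N_AbsTopIII_Cor5_5_i_part

/-- [node AbsTopIII:Cor5.10(iv) · L4/D1 · DAG status discharged(p411254+p481393+p478105)] discharge witness of `N_AbsTopIII_Cor5_10_iv` (indexed in `DAGL4u` with `_part` while the row was landed; now discharged, p411254): BY NAME; proves nothing new. -/
theorem N_AbsTopIII_Cor5_10_iv_holds : N_AbsTopIII_Cor5_10_iv := N_AbsTopIII_Cor5_10_iv_part

/-- [node AbsTopI:Thm2.6(i) · L4/D1 · DAG status discharged(p488312+p447367)] discharge witness of `N_AbsTopI_Thm2_6_i` (indexed in `DAGL4u` with `_part` while the row was landed; now discharged, p488312): BY NAME; proves nothing new. -/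
theorem N_AbsTopI_Thm2_6_i_holds : N_AbsTopI_Thm2_6_i := N_AbsTopI_Thm2_6_i_part

/-- [node AbsTopI:Prop4.10(ii) · L4/D1 · DAG status discharged(p490726)] discharge witness of `N_AbsTopI_Prop4_10_ii` (indexed in `DAGXc` with `_part` while the row was landed; now discharged, p490726): BY NAME; proves nothing new. -/
theorem N_AbsTopI_Prop4_10_ii_holds : N_AbsTopI_Prop4_10_ii := N_AbsTopI_Prop4_10_ii_part

/-- [node AbsAnab:Lem2.5(ii) · L4/D1 · DAG status discharged(p491328)] discharge witness of `N_AbsAnab_Lem2_5_ii` (indexed in `DAGXc` with `_part` while the row was landed; now discharged, p491328): BY NAME; proves nothing new. -/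
theorem N_AbsAnab_Lem2_5_ii_holds : N_AbsAnab_Lem2_5_ii := N_AbsAnab_Lem2_5_ii_part

end Summit.ABC.IUTFork.DAG
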